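import Mathlib.Order.Interval.Finset.Nat
import Mathlib.Tactic.Tauto
import Mathlib.Tactic.Ring
import HarnessLib

/-!
# `NoHeavyLowerTail` (stmt-CriticalPhenomena-4575) — antithetic cluster pairs: THEOREM C′, the BOUNDARY COUNT, part 1 — the abstract
# threshold counting lemma BL′ (prim-hp-2 gen 44; HOME/THEOREM-Cprime-delta2-cycle.md §6)

Support file (`--supports stmt-CriticalPhenomena-4575`, hull-port prover `prim-hp-2`, gen 44).  No named facts, no sorries; standard axioms.
The `def`s `Antithetic.BCount.{rbBad, brBad, arcGood, fullGood, rbOne, brTwo}` are proof-internal bookkeeping (finite index sets).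

PURE COMBINATORICS (no graphs).  In the boundary layer of THEOREM C′ (cycle `v 0 = s, …, v (n−1)`, `y = v p`, `z = v q`, `0 < p, q < n`,
`p ≠ q`), for a pair of upper sets `U, W` the lifted clusters of the boundary colourings are members of four CHAINS `Pr_i, Pb_i, Qr_j, Qb_j`
(`1 ≤ i, j ≤ n − 1`), of the near-full ARCS `Ae_k, Af_k` (`1 ≤ k ≤ n − 2`) and the two FULL sets `Ee, Ef`.  Membership of a chain element in an
upper set is a THRESHOLD condition: `Pr_i ∈ U ↔ ar ≤ i`, `Pb_i ∈ U ↔ ab ≤ i`, `Qr_j ∈ U ↔ cr ≤ j`, `Qb_j ∈ U ↔ cb ≤ j` (thresholds in `[1, n]`,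
`n` = never), and `br, bb, dr, db` for `W`.  The chain inclusions force `ar < p → ab ≤ ar`, `ab < q → ar ≤ ab`, `cr < n − p → cb ≤ cr`,
`cb < n − q → cr ≤ cb` (same for `W`); the arcs contain the chains: `Ae_k ∈ U` if `ar ≤ k ∨ cr ≤ n − 1 − k`, `Af_k ∈ U` if
`ab ≤ k ∨ cb ≤ n − 1 − k`, `Ee ∈ U` if `ar < n ∨ cr < n`, `Ef ∈ U` if `ab < n ∨ cb < n`.
An indicator term `(𝟙_U X − 𝟙_U X′)(𝟙_W X − 𝟙_W X′)` is `−1` iff its membership pattern `(X∈U, X′∈U, X∈W, X′∈W)` is `(1,0,0,1)` (TYPE 1) or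
`(0,1,1,0)` (TYPE 2) — "BAD".  The one-change terms are
`(X, X′) = (Pr_i, Qb_{n−i})` (`rb`, absent for `p ≤ i ≤ q`) and `(Qr_{n−i}, Pb_i)` (`br`, absent for `q ≤ i ≤ p`); the arc / full terms are `≥ 0`
and equal to `1` when the arc / full set lies in `U ∩ W`.
* `Antithetic.BCount.count` — **the counting lemma BL′**: #bad one-change terms ≤ #good arc and full terms (forced memberships only), for all
  thresholds obeying the constraints, every `p ≠ q`.  Proof (theorem file §6): the bad terms of types 1/2 (`rb`) and 1′/2′ (`br`) satisfy
  "1 & 2, 1′ & 2′, 1 & 1′, 2 & 2′ never coexist" (`excl`), the cross count `#1 + #2′ ≤ len[ar, n−dr] + len[ab, n−db]` (`cross_le`, three cases), and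
  `len[a, n−d] ≤ #good` (`len_le_good`); the case `q < p` is the reflection `i ↦ n − i` of the case `p < q`.
Exhaustively machine-checked for `n ≤ 7` over all thresholds (HOME/code/gen44/lab/absthr.py) before formalisation.
[cite: VandenbergHaggstromKahn2005, §1 p. 3 (open cluster `C_s`)]
-/

namespace Summit.CriticalPhenomena.PercolationContinuityZ3.Theorems

open scoped Classical

namespace Antithetic

namespace BCount

/-- Bad `rb` one-change positions `i ∈ [1, n−1] ∖ [p, q]` (term `(Pr_i, Qb_{n−i})`) for thresholds `ar, cb` (`U`) and `br, db` (`W`). [this work] -/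
noncomputable def rbBad (n p q ar cb br db : ℕ) : Finset ℕ :=
  (Finset.Icc 1 (n - 1)).filter fun i => ¬ (p ≤ i ∧ i ≤ q) ∧
    ((ar ≤ i ∧ ¬ cb ≤ n - i ∧ ¬ br ≤ i ∧ db ≤ n - i) ∨ (¬ ar ≤ i ∧ cb ≤ n - i ∧ br ≤ i ∧ ¬ db ≤ n - i))

/-- Bad `br` one-change positions `i ∈ [1, n−1] ∖ [q, p]` (term `(Qr_{n−i}, Pb_i)`) for thresholds `cr, ab` (`U`) and `dr, bb` (`W`). [this work] -/
noncomputable def brBad (n p q cr ab dr bb : ℕ) : Finset ℕ :=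
  (Finset.Icc 1 (n - 1)).filter fun i => ¬ (q ≤ i ∧ i ≤ p) ∧
    ((cr ≤ n - i ∧ ¬ ab ≤ i ∧ ¬ dr ≤ n - i ∧ bb ≤ i) ∨ (¬ cr ≤ n - i ∧ ab ≤ i ∧ dr ≤ n - i ∧ ¬ bb ≤ i))

/-- Forced good arc positions `k ∈ [1, n−2]`: the arc over the chains with thresholds `a` (clockwise) and `c` (counter-clockwise) lies in `U`
as soon as `a ≤ k ∨ c ≤ n−1−k`; idem `b, d` for `W`. [this work] -/
noncomputable def arcGood (n a c b d : ℕ) : Finset ℕ :=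
  (Finset.Icc 1 (n - 2)).filter fun k => (a ≤ k ∨ c ≤ n - 1 - k) ∧ (b ≤ k ∨ d ≤ n - 1 - k)

/-- Forced good full term: `1` if the full set lies in `U ∩ W`, which is forced as soon as some chain element does (`a < n ∨ c < n`, and
`b < n ∨ d < n`). [this work] -/
noncomputable def fullGood (n a c b d : ℕ) : ℕ := if (a < n ∨ c < n) ∧ (b < n ∨ d < n) then 1 else 0

/-- Bad `rb` positions of TYPE 1 (pattern `(1,0,0,1)`): `ar ≤ i < br`, `db ≤ n − i < cb`.  Type 2 is `rbOne` with `(ar, cb) ↔ (br, db)`. [this work] -/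
noncomputable def rbOne (n p q ar cb br db : ℕ) : Finset ℕ :=
  (Finset.Icc 1 (n - 1)).filter fun i => ¬ (p ≤ i ∧ i ≤ q) ∧ (ar ≤ i ∧ ¬ cb ≤ n - i ∧ ¬ br ≤ i ∧ db ≤ n - i)

/-- Bad `br` positions of TYPE 2′ (pattern `(0,1,1,0)`): `ab ≤ i < bb`, `dr ≤ n − i < cr`.  Type 1′ is `brTwo` with `(cr, ab) ↔ (dr, bb)`. [this work] -/
noncomputable def brTwo (n p q cr ab dr bb : ℕ) : Finset ℕ :=
  (Finset.Icc 1 (n - 1)).filter fun i => ¬ (q ≤ i ∧ i ≤ p) ∧ (¬ cr ≤ n - i ∧ ab ≤ i ∧ dr ≤ n - i ∧ ¬ bb ≤ i)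

section Mem

variable {n p q a b c d i : ℕ}

/-- Membership in `rbBad`. [this work] -/
theorem mem_rbBad : i ∈ rbBad n p q a c b d ↔ (1 ≤ i ∧ i ≤ n - 1) ∧ ¬ (p ≤ i ∧ i ≤ q) ∧
    ((a ≤ i ∧ ¬ c ≤ n - i ∧ ¬ b ≤ i ∧ d ≤ n - i) ∨ (¬ a ≤ i ∧ c ≤ n - i ∧ b ≤ i ∧ ¬ d ≤ n - i)) := by
  rw [rbBad, Finset.mem_filter, Finset.mem_Icc]

/-- Membership in `brBad`. [this work] -/
theorem mem_brBad : i ∈ brBad n p q c a d b ↔ (1 ≤ i ∧ i ≤ n - 1) ∧ ¬ (q ≤ i ∧ i ≤ p) ∧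
    ((c ≤ n - i ∧ ¬ a ≤ i ∧ ¬ d ≤ n - i ∧ b ≤ i) ∨ (¬ c ≤ n - i ∧ a ≤ i ∧ d ≤ n - i ∧ ¬ b ≤ i)) := by
  rw [brBad, Finset.mem_filter, Finset.mem_Icc]

/-- Membership in `arcGood`. [this work] -/
theorem mem_arcGood {k : ℕ} : k ∈ arcGood n a c b d ↔ (1 ≤ k ∧ k ≤ n - 2) ∧ (a ≤ k ∨ c ≤ n - 1 - k) ∧ (b ≤ k ∨ d ≤ n - 1 - k) := by
  rw [arcGood, Finset.mem_filter, Finset.mem_Icc]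

/-- Membership in `rbOne`. [this work] -/
theorem mem_rbOne : i ∈ rbOne n p q a c b d ↔ (1 ≤ i ∧ i ≤ n - 1) ∧ ¬ (p ≤ i ∧ i ≤ q) ∧ (a ≤ i ∧ ¬ c ≤ n - i ∧ ¬ b ≤ i ∧ d ≤ n - i) := by
  rw [rbOne, Finset.mem_filter, Finset.mem_Icc]

/-- Membership in `brTwo`. [this work] -/
theorem mem_brTwo : i ∈ brTwo n p q c a d b ↔ (1 ≤ i ∧ i ≤ n - 1) ∧ ¬ (q ≤ i ∧ i ≤ p) ∧ (¬ c ≤ n - i ∧ a ≤ i ∧ d ≤ n - i ∧ ¬ b ≤ i) := by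
  rw [brTwo, Finset.mem_filter, Finset.mem_Icc]

end Mem

section Pieces

variable {n p q ar ab cr cb br bb dr db : ℕ}

/-- Every bad `rb` position is of type 1 or of type 2. [this work] -/
theorem rbBad_subset : rbBad n p q ar cb br db ⊆ rbOne n p q ar cb br db ∪ rbOne n p q br db ar cb := by
  intro i hi
  rw [Finset.mem_union, mem_rbOne, mem_rbOne]
  rw [mem_rbBad] at hi
  tauto

/-- Every bad `br` position is of type 2′ or of type 1′. [this work] -/
theorem brBad_subset : brBad n p q cr ab dr bb ⊆ brTwo n p q cr ab dr bb ∪ brTwo n p q dr bb cr ab := by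
  intro i hi
  rw [Finset.mem_union, mem_brTwo, mem_brTwo]
  rw [mem_brBad] at hi
  tauto

/-- Types 1 and 2 do not coexist (`ar < br` versus `br < ar`). [this work] -/
theorem rbOne_eq_empty_of (h : (rbOne n p q ar cb br db).Nonempty) : rbOne n p q br db ar cb = ∅ := by
  obtain ⟨i, hi⟩ := h
  rw [mem_rbOne] at hi
  refine Finset.eq_empty_of_forall_notMem fun j hj => ?_
  rw [mem_rbOne] at hj
  omega

/-- Types 2′ and 1′ do not coexist (`ab < bb` versus `bb < ab`). [this work] -/
theorem brTwo_eq_empty_of (h : (brTwo n p q cr ab dr bb).Nonempty) : brTwo n p q dr bb cr ab = ∅ := by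
  obtain ⟨i, hi⟩ := h
  rw [mem_brTwo] at hi
  refine Finset.eq_empty_of_forall_notMem fun j hj => ?_
  rw [mem_brTwo] at hj
  omega

/-- **Incompatibility of types 1 and 1′** (`p < q`; uses the chain constraints on both sides). [this work] -/
theorem excl (hpq : p < q) (hqn : q < n) (hU1 : ar < p → ab ≤ ar) (hU3 : cr < n - p → cb ≤ cr) (hW2 : bb < q → br ≤ bb)
    (hW4 : db < n - q → dr ≤ db) (h1 : (rbOne n p q ar cb br db).Nonempty) (h1' : (brTwo n p q dr bb cr ab).Nonempty) : False := by
  obtain ⟨i, hi⟩ := h1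
  obtain ⟨k, hk⟩ := h1'
  rw [mem_rbOne] at hi
  rw [mem_brTwo] at hk
  omega

/-- The good terms pay for an interval: `len[a, n−d] ≤ #(forced good arcs) + (forced good full term)`. [this work] -/
theorem len_le_good {a c b d : ℕ} (ha : 1 ≤ a) (hd : 1 ≤ d) :
    n + 1 - d - a ≤ (arcGood n a c b d).card + fullGood n a c b d := by
  by_cases h : a + d ≤ n
  · have hsub : Finset.Icc a (n - 1 - d) ⊆ arcGood n a c b d := by
      intro k hk
      rw [Finset.mem_Icc] at hk
      rw [mem_arcGood]
      omega
    have hc := Finset.card_le_card hsub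
    rw [Nat.card_Icc] at hc
    have hf : fullGood n a c b d = 1 := if_pos ⟨Or.inl (by omega), Or.inr (by omega)⟩
    omega
  · have : n + 1 - d - a = 0 := by omega
    omega

/-- `arcGood` is symmetric in `U ↔ W`. [this work] -/
theorem arcGood_swap {a c b d : ℕ} : arcGood n a c b d = arcGood n b d a c := by
  ext k
  rw [mem_arcGood, mem_arcGood]
  tauto

/-- `fullGood` is symmetric in `U ↔ W`. [this work] -/
theorem fullGood_swap {a c b d : ℕ} : fullGood n a c b d = fullGood n b d a c := by
  unfold fullGood
  exact if_congr and_comm rfl rfl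

/-- `len[b, n−c] ≤ #good` (the `U ↔ W` swap of `len_le_good`). [this work] -/
theorem len_le_good' {a c b d : ℕ} (hb : 1 ≤ b) (hc : 1 ≤ c) :
    n + 1 - c - b ≤ (arcGood n a c b d).card + fullGood n a c b d := by
  rw [arcGood_swap, fullGood_swap]
  exact len_le_good hb hc

/-- **The cross count** (`p < q`): `#(type 1) + #(type 2′) ≤ len[ar, n−dr] + len[ab, n−db]` — three cases: `dr = db` (some `d < n−q`),
`ar = ab` (some `a < p`), or type 1 is empty and type 2′ is paid by one of the two intervals. [this work] -/
theorem cross_le (hpq : p < q) (hqn : q < n) (hdrn : dr ≤ n) (hdbn : db ≤ n) (hU1 : ar < p → ab ≤ ar) (hU2 : ab < q → ar ≤ ab)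
    (hW3 : dr < n - p → db ≤ dr) (hW4 : db < n - q → dr ≤ db) :
    (rbOne n p q ar cb br db).card + (brTwo n p q cr ab dr bb).card ≤ (n + 1 - dr - ar) + (n + 1 - db - ab) := by
  -- the two pieces live in intervals
  have hrb : rbOne n p q ar cb br db ⊆ Finset.Icc ar (n - db) := by
    intro i hi
    rw [mem_rbOne] at hi
    rw [Finset.mem_Icc]
    omega
  have hbr : brTwo n p q cr ab dr bb ⊆ Finset.Icc ab (n - dr) := by
    intro i hi
    rw [mem_brTwo] at hi
    rw [Finset.mem_Icc]
    omega
  have crb := Finset.card_le_card hrb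
  have cbr := Finset.card_le_card hbr
  rw [Nat.card_Icc] at crb cbr
  by_cases h1 : dr < n - q ∨ db < n - q
  · -- case (i): dr = db
    have hdd : dr = db := by omega
    omega
  by_cases h2 : ar < p ∨ ab < p
  · -- case (ii): ar = ab
    have haa : ar = ab := by omega
    omega
  -- case (iii): type 1 is empty
  have he : rbOne n p q ar cb br db = ∅ := by
    refine Finset.eq_empty_of_forall_notMem fun i hi => ?_
    rw [mem_rbOne] at hi
    omega
  rw [he, Finset.card_empty, zero_add]
  by_cases h3 : ab < q
  · have := hU2 h3
    omega
  · -- `ab ≥ q ≥ n − dr`: the interval `[ab, n − dr]` has at most one point, and then `[ab, n − db]` is non-empty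
    omega

/-- **BL′ for `p < q`.** [this work] -/
theorem count_lt (hpq : p < q) (hqn : q < n)
    (har : 1 ≤ ar) (hab : 1 ≤ ab) (hcr : 1 ≤ cr) (hcb : 1 ≤ cb) (hbr : 1 ≤ br) (hbb : 1 ≤ bb) (hdr : 1 ≤ dr) (hdb : 1 ≤ db)
    (hcrn : cr ≤ n) (hcbn : cb ≤ n) (hdrn : dr ≤ n) (hdbn : db ≤ n)
    (hU1 : ar < p → ab ≤ ar) (hU2 : ab < q → ar ≤ ab) (hU3 : cr < n - p → cb ≤ cr) (hU4 : cb < n - q → cr ≤ cb)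
    (hW1 : br < p → bb ≤ br) (hW2 : bb < q → br ≤ bb) (hW3 : dr < n - p → db ≤ dr) (hW4 : db < n - q → dr ≤ db) :
    (rbBad n p q ar cb br db).card + (brBad n p q cr ab dr bb).card ≤
      (arcGood n ar cr br dr).card + (arcGood n ab cb bb db).card + fullGood n ar cr br dr + fullGood n ab cb bb db := by
  have hB : (rbBad n p q ar cb br db).card + (brBad n p q cr ab dr bb).card ≤
      ((rbOne n p q ar cb br db).card + (rbOne n p q br db ar cb).card) +
        ((brTwo n p q cr ab dr bb).card + (brTwo n p q dr bb cr ab).card) :=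
    add_le_add ((Finset.card_le_card rbBad_subset).trans (Finset.card_union_le _ _))
      ((Finset.card_le_card brBad_subset).trans (Finset.card_union_le _ _))
  have T := cross_le (cr := cr) (cb := cb) (br := br) (bb := bb) hpq hqn hdrn hdbn hU1 hU2 hW3 hW4
  have T' := cross_le (cr := dr) (cb := db) (br := ar) (bb := ab) hpq hqn hcrn hcbn hW1 hW2 hU3 hU4
  have Ge := len_le_good (n := n) (c := cr) (b := br) har hdr
  have Gf := len_le_good (n := n) (c := cb) (b := bb) hab hdb
  have Ge' := len_le_good' (n := n) (a := ar) (d := dr) hbr hcr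
  have Gf' := len_le_good' (n := n) (a := ab) (d := db) hbb hcb
  by_cases h1 : (rbOne n p q ar cb br db).Nonempty
  · have e1 : rbOne n p q br db ar cb = ∅ := rbOne_eq_empty_of h1
    have e2 : brTwo n p q dr bb cr ab = ∅ := by
      by_contra hne
      exact excl hpq hqn hU1 hU3 hW2 hW4 h1 (Finset.nonempty_iff_ne_empty.2 hne)
    rw [e1, e2, Finset.card_empty] at hB
    omega
  by_cases h2 : (brTwo n p q cr ab dr bb).Nonempty
  · have e1 : brTwo n p q dr bb cr ab = ∅ := brTwo_eq_empty_of h2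
    have e2 : rbOne n p q br db ar cb = ∅ := by
      by_contra hne
      exact excl hpq hqn hW1 hW3 hU2 hU4 (Finset.nonempty_iff_ne_empty.2 hne) h2
    rw [e1, e2, Finset.card_empty] at hB
    omega
  have e1 : rbOne n p q ar cb br db = ∅ := Finset.not_nonempty_iff_eq_empty.1 h1
  have e2 : brTwo n p q cr ab dr bb = ∅ := Finset.not_nonempty_iff_eq_empty.1 h2
  rw [e1, e2, Finset.card_empty] at hB
  omega

end Pieces

section Reflect

variable {n p q a b c d : ℕ}

/-- Reflection `i ↦ n − i`: the bad `rb` positions for `(p, q)` are the bad `br` positions for `(n−p, n−q)` with reflected roles. [this work] -/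
theorem card_rbBad_reflect (hp : p ≤ n) (hq : q ≤ n) : (rbBad n p q a c b d).card = (brBad n (n - p) (n - q) a c b d).card := by
  refine Finset.card_nbij' (fun i => n - i) (fun i => n - i) (fun i hi => ?_) (fun i hi => ?_) (fun i hi => ?_) (fun i hi => ?_)
  · rw [Finset.mem_coe, mem_rbBad] at hi
    show n - i ∈ brBad n (n - p) (n - q) a c b d
    rw [mem_brBad, show n - (n - i) = i by omega]
    omega
  · rw [Finset.mem_coe, mem_brBad] at hi
    show n - i ∈ rbBad n p q a c b d
    rw [mem_rbBad, show n - (n - i) = i by omega]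
    omega
  · rw [Finset.mem_coe, mem_rbBad] at hi
    show n - (n - i) = i
    omega
  · rw [Finset.mem_coe, mem_brBad] at hi
    show n - (n - i) = i
    omega

/-- Reflection `i ↦ n − i` for the `br` positions. [this work] -/
theorem card_brBad_reflect (hp : p ≤ n) (hq : q ≤ n) : (brBad n p q c a d b).card = (rbBad n (n - p) (n - q) c a d b).card := by
  refine Finset.card_nbij' (fun i => n - i) (fun i => n - i) (fun i hi => ?_) (fun i hi => ?_) (fun i hi => ?_) (fun i hi => ?_)
  · rw [Finset.mem_coe, mem_brBad] at hi
    show n - i ∈ rbBad n (n - p) (n - q) c a d b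
    rw [mem_rbBad, show n - (n - i) = i by omega]
    omega
  · rw [Finset.mem_coe, mem_rbBad] at hi
    show n - i ∈ brBad n p q c a d b
    rw [mem_brBad, show n - (n - i) = i by omega]
    omega
  · rw [Finset.mem_coe, mem_brBad] at hi
    show n - (n - i) = i
    omega
  · rw [Finset.mem_coe, mem_rbBad] at hi
    show n - (n - i) = i
    omega

/-- Reflection `k ↦ n − 1 − k` for the arcs: clockwise and counter-clockwise thresholds exchange. [this work] -/
theorem card_arcGood_reflect : (arcGood n a c b d).card = (arcGood n c a d b).card := by
  refine Finset.card_nbij' (fun k => n - 1 - k) (fun k => n - 1 - k) (fun k hk => ?_) (fun k hk => ?_) (fun k hk => ?_) (fun k hk => ?_)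
  · rw [Finset.mem_coe, mem_arcGood] at hk
    show n - 1 - k ∈ arcGood n c a d b
    rw [mem_arcGood, show n - 1 - (n - 1 - k) = k by omega]
    omega
  · rw [Finset.mem_coe, mem_arcGood] at hk
    show n - 1 - k ∈ arcGood n a c b d
    rw [mem_arcGood, show n - 1 - (n - 1 - k) = k by omega]
    omega
  · rw [Finset.mem_coe, mem_arcGood] at hk
    show n - 1 - (n - 1 - k) = k
    omega
  · rw [Finset.mem_coe, mem_arcGood] at hk
    show n - 1 - (n - 1 - k) = k
    omega

/-- Reflection for the full term. [this work] -/
theorem fullGood_reflect : fullGood n a c b d = fullGood n c a d b := by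
  unfold fullGood
  exact if_congr (and_congr or_comm or_comm) rfl rfl

end Reflect

/-- **THE COUNTING LEMMA BL′** (THEOREM C′ §6), every `p ≠ q`: the number of bad one-change terms is at most the number of (forced) good arc
and full terms. [this work] -/
theorem count {n p q ar ab cr cb br bb dr db : ℕ} (hpn : p < n) (hq0 : 0 < q) (hqn : q < n) (hpq : p ≠ q)
    (har : 1 ≤ ar) (hab : 1 ≤ ab) (hcr : 1 ≤ cr) (hcb : 1 ≤ cb) (hbr : 1 ≤ br) (hbb : 1 ≤ bb) (hdr : 1 ≤ dr) (hdb : 1 ≤ db)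
    (harn : ar ≤ n) (habn : ab ≤ n) (hcrn : cr ≤ n) (hcbn : cb ≤ n) (hbrn : br ≤ n) (hbbn : bb ≤ n) (hdrn : dr ≤ n) (hdbn : db ≤ n)
    (hU1 : ar < p → ab ≤ ar) (hU2 : ab < q → ar ≤ ab) (hU3 : cr < n - p → cb ≤ cr) (hU4 : cb < n - q → cr ≤ cb)
    (hW1 : br < p → bb ≤ br) (hW2 : bb < q → br ≤ bb) (hW3 : dr < n - p → db ≤ dr) (hW4 : db < n - q → dr ≤ db) :
    (rbBad n p q ar cb br db).card + (brBad n p q cr ab dr bb).card ≤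
      (arcGood n ar cr br dr).card + (arcGood n ab cb bb db).card + fullGood n ar cr br dr + fullGood n ab cb bb db := by
  rcases Nat.lt_or_gt_of_ne hpq with hlt | hgt
  · exact count_lt hlt hqn har hab hcr hcb hbr hbb hdr hdb hcrn hcbn hdrn hdbn hU1 hU2 hU3 hU4 hW1 hW2 hW3 hW4
  · -- reflect: positions i ↦ n − i, arcs k ↦ n − 1 − k, (p, q) ↦ (n − p, n − q), clockwise ↔ counter-clockwise thresholds
    have hlt : n - p < n - q := by omega
    have key := count_lt (n := n) (p := n - p) (q := n - q) (ar := cr) (ab := cb) (cr := ar) (cb := ab) (br := dr) (bb := db)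
      (dr := br) (db := bb) hlt (by omega) hcr hcb har hab hdr hdb hbr hbb harn habn hbrn hbbn hU3 hU4
      (fun h => hU1 (by omega)) (fun h => hU2 (by omega)) hW3 hW4 (fun h => hW1 (by omega)) (fun h => hW2 (by omega))
    rw [← card_brBad_reflect hpn.le hqn.le, ← card_rbBad_reflect hpn.le hqn.le, card_arcGood_reflect (a := cr), card_arcGood_reflect (a := cb),
      fullGood_reflect (a := cr), fullGood_reflect (a := cb)] at key
    omega

end BCount

end Antithetic

end Summit.CriticalPhenomena.PercolationContinuityZ3.Theorems
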